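import Literature.NumberTheory.LFunctions.MertensFirstChainCheck
import HarnessLib

/-!
# Rosser–Schoenfeld's (3.22) by kernel computation: certified run extended, chunks 11–13
# (primes `2707127 → 3605923`)

Topic: `Literature/NumberTheory/LFunctions`. Pure proof file (a kernel computation; nothing is asserted, no
definition). Part of the discharge programme of `Literature.NumberTheory.LFunctions.RosserSchoenfeld1962_eq_3_22`
(Rosser–Schoenfeld 1962, Thm. 6 (3.22): `Σ_{p ≤ x} (log p)/p < log x + E + 1/(2 log x)` for `x ≥ 319`). The tree's
certified run `MertensFirstChainRun1/2.lean` reaches the prime `442439`; the three files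
`MertensFirstChainRun3/4/5.lean` (chunks 3–13, `20000` table entries each, primes `442439 → 3605923`) carry the
same chain — each step certifying the next prime, extending the enclosure of `log p`, the majorants of
`Σ_{q ≤ p} (log q)/q` and `Σ_{q ≤ p} (log q)/(q(q−1))`, and performing the comparison `chkM` behind (3.22) at the new
prime — past Dusart's threshold `3 594 641`, so that (3.22) follows for ALL `x ≥ 319` from the tree's named fact
`Dusart2010_theta_thm_5_2` (assembly: `RosserSchoenfeldEq322FromDusart.lean`). The expected states were obtained
by evaluating the same function compiled (`#eval` on the Lean farm, 2026-08-28; all comparisons pass). The meaning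
of the states is `MertensFirstChain.runDM_sound` / `eq_3_22_of_inv` (`MertensFirstChainSound.lean`).
`decide +kernel`, standard axioms only (`maxHeartbeats 0`).

## References
* J. B. Rosser, L. Schoenfeld, Illinois J. Math. 6 (1962), 64–94, Thm. 6 (3.22) and p. 87 (the range below `10⁸`
  by the Rosser–Walker and Appel–Rosser tables). [RosserSchoenfeld1962]
-/

namespace Literature.NumberTheory.LFunctions.MertensFirstChainRun

open MertensFirstChain

set_option maxHeartbeats 0 in
/-- **Chunk 11 of the certified Mertens run** (`20000` steps, primes `2707127` to `3004543`).
[cite: RosserSchoenfeld1962, Thm. 6 (3.22)] -/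
theorem run11 :
    runDM 20000
      ⟨2707127, 17905882050579067599704369, 17905882050579543210591904,
        16295721812353906201685551, 913181752655690908904298⟩ =
    some ⟨3004543, 18031897518104434366164262, 18031897518104909977522732,
        16421678715124424004626630, 913181796839210480936646⟩ := by
  decide +kernel

set_option maxHeartbeats 0 in
/-- **Chunk 12 of the certified Mertens run** (`20000` steps, primes `3004543` to `3303551`).
[cite: RosserSchoenfeld1962, Thm. 6 (3.22)] -/
theorem run12 :
    runDM 20000
      ⟨3004543, 18031897518104434366164262, 18031897518104909977522732,
        16421678715124424004626630, 913181796839210480936646⟩ =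
    some ⟨3303551, 18146591301475987146091229, 18146591301476462757912579,
        16536467970132565983611496, 913181833285514053575077⟩ := by
  decide +kernel

set_option maxHeartbeats 0 in
/-- **Chunk 13 of the certified Mertens run** (`20000` steps, primes `3303551` to `3605923`).
[cite: RosserSchoenfeld1962, Thm. 6 (3.22)] -/
theorem run13 :
    runDM 20000
      ⟨3303551, 18146591301475987146091229, 18146591301476462757912579,
        16536467970132565983611496, 913181833285514053575077⟩ =
    some ⟨3605923, 18252468808012926849261841, 18252468808013402461545876,
        16641905285526118774939865, 913181863846104202998342⟩ := by
  decide +kernel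

end Literature.NumberTheory.LFunctions.MertensFirstChainRun
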